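import Summits.Schanuel.Schanuel.Theorems.ZilberEacFibrationMM
import Summits.Schanuel.Schanuel.Theorems.ZilberEacFibreLastCyl
import Summits.Schanuel.Schanuel.Theorems.ZilberEacTorusRuledPeriodic
import Literature.ModelTheory.Zilber.EACDensityOscillatory
import HarnessLib

/-!
# Torus-ruled members of `EC(3,2)`: the residual piece is Mantova–Masser's (free) density question

Zilber's Exponential-Algebraic Closedness, case ladder (host summit Schanuel, cell `pub-schanuel`,
seat 2, gen 5).  Gen 4 (`ZilberEacTorusRuledPeriodic`) proved that every TORUS-RULED member of the
cell `ECCell 3 2` meets `Γ_exp`, granted the single residual configuration "base period `e₃` and `W`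
a `y₃`-cylinder" (`inter_expGraph_nonempty_of_isTorusStable_three_two`, hypothesis `hres`).  Gen 5
closes the loop:

* `zariskiDim_image_dropLastMat_eq_of_isCoordCylinder`: a rotund `y_last`-cylinder has
  `dim cl[Δ_d](W ∩ Gⁿ) = d` (`≤` by `ZilberEacFibreLastCyl`, `≥` by rotundity), i.e. lies in the FIBRED
  periodic piece `ECCellPeriodicStdFib d`;
* `ecCellPeriodicStdFib_two_of_mmDensityFree`: the REPAIRED bridge.  Seat 1 (gen 9,
  `EACDensityOscillatory`) showed that the transcribed density question WITHOUT multiplicative freeness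
  is FALSE (`not_forall_mmCaseDimPiOneFree_unprojectedDense`, witness the resonant parabola
  `{x₁ = x₀²/(2πi), y₀ = 1}`), so the hypothesis of `ecCellPeriodicStdFib_two_of_mmDensity`
  (`ZilberEacFibrationMM`) is vacuous; the repaired hypothesis asks density only for surfaces of case
  (dim-π-S-1-free) whose torus part is MULTIPLICATIVELY FREE — available here, since the binders of
  `ECCellPeriodicStdFib 2` include `IsMulFree` and freeness descends to the projection
  (`isMulFree_projClosure_inter_torusLocus`, seat 1);
* `inter_expGraph_nonempty_of_isTorusStable_of_mmDensityFree`: hence a YES to the free density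
  question implies that EVERY torus-ruled member of `ECCell 3 2` meets `Γ_exp`.

HONEST FRAMING: an implication between a question OPEN in print (in its free form) and an OPEN
structural sub-case; `EC(3,2)` OPEN; nothing here bears on Schanuel's conjecture (EAC ⇏ SC).
-/

noncomputable section

open MvPolynomial
open Literature.NumberTheory.Transcendental Literature.ModelTheory.Zilber

set_option linter.dupNamespace false

namespace Summit.Schanuel.Schanuel.Theorems

variable {d : ℕ}

/-- **A rotund `y_last`-cylinder lies in the fibred piece**: `dim cl[Δ_d](W ∩ Gⁿ) = d`. [folklore] -/
theorem zariskiDim_image_dropLastMat_eq_of_isCoordCylinder {W : Set (Fin (d + 1) ⊕ Fin (d + 1) → ℂ)}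
    (hW : IsIrreducibleClosed ℂ W) (hne : (W ∩ torusLocus ℂ (d + 1)).Nonempty)
    (hrot : IsRotund ℂ (d + 1) (W ∩ torusLocus ℂ (d + 1))) (hdim : zariskiDim ℂ W = (d + 1 : ℕ))
    (hcyl : IsCoordCylinder W (Sum.inr (Fin.last d))) :
    zariskiDim ℂ (matrixAct (dropLastMat d) '' (W ∩ torusLocus ℂ (d + 1))) = d := by
  classical
  refine le_antisymm ?_ (le_zariskiDim_image_dropLastMat hrot)
  have hWP : W = zeroLocus ℂ (vanishingIdeal ℂ W) := eq_zeroLocus_vanishingIdeal_of_isZariskiClosed hW.1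
  haveI : (vanishingIdeal ℂ W).IsPrime := hW.2
  rw [hWP] at hne hdim hcyl ⊢
  exact zariskiDim_image_dropLastMat_le_of_isCoordCylinder (vanishingIdeal ℂ W) hne hdim hcyl

/-- **The repaired bridge: Mantova–Masser's FREE density question ⇒ the fibred periodic piece of
`EC(3,2)`.**  If every surface `S ⊆ ℂ² × ℂ²` of case (dim-π-S-1-free) with multiplicatively free torus
part has Zariski-dense exponential points, then `ECCellPeriodicStdFib 2` holds: the projected surface
`cl pr(W ∩ G³)` is of that case (`mmCaseDimPiOneFree_projClosure`), its torus part is free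
(`isMulFree_projClosure_inter_torusLocus`), and the fibration principle
`inter_expGraph_nonempty_of_unprojectedDense_proj` concludes.
[cite: MantovaMasser2023, §1 Further remarks, p. 5] -/
theorem ecCellPeriodicStdFib_two_of_mmDensityFree
    (h : ∀ S : Set (Fin 2 ⊕ Fin 2 → ℂ), MMCaseDimPiOneFree S →
      IsMulFree ℂ 2 (S ∩ torusLocus ℂ 2) → UnprojectedDense S) :
    ECCellPeriodicStdFib 2 := by
  intro W hW hne _ hadd hmul hdim hbase hper hfib
  exact inter_expGraph_nonempty_of_unprojectedDense_proj hW hne hdim hfib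
    (h _ (mmCaseDimPiOneFree_projClosure hW hne hadd hbase hper hfib)
      (isMulFree_projClosure_inter_torusLocus hmul))

/-- **Mantova–Masser's free density question ⇒ every torus-ruled member of `ECCell 3 2` meets
`Γ_exp`.**  If every surface `S ⊆ ℂ² × ℂ²` of case (dim-π-S-1-free) with multiplicatively free torus
part has Zariski-dense exponential points, then every `W` with the binders of `ECCell 3 2` whose torus
part is stable under a one-parameter subtorus `y ↦ y·t^ν` (`ν ≠ 0`) meets the graph of
exponentiation: gen 4's `inter_expGraph_nonempty_of_isTorusStable_three_two` reduces to the residual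
`y₃`-cylinders with base period `e₃`, which lie in `ECCellPeriodicStdFib 2`
(`zariskiDim_image_dropLastMat_eq_of_isCoordCylinder`). [cite: MantovaMasser2023, §1 Further remarks] -/
theorem inter_expGraph_nonempty_of_isTorusStable_of_mmDensityFree
    (h : ∀ S : Set (Fin 2 ⊕ Fin 2 → ℂ), MMCaseDimPiOneFree S →
      IsMulFree ℂ 2 (S ∩ torusLocus ℂ 2) → UnprojectedDense S)
    {W : Set (Fin (2 + 1) ⊕ Fin (2 + 1) → ℂ)} (hW : IsIrreducibleClosed ℂ W)
    (hne : (W ∩ torusLocus ℂ (2 + 1)).Nonempty) (hrot : IsRotund ℂ (2 + 1) (W ∩ torusLocus ℂ (2 + 1)))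
    (hadd : IsAddFree ℂ (2 + 1) (W ∩ torusLocus ℂ (2 + 1)))
    (hmul : IsMulFree ℂ (2 + 1) (W ∩ torusLocus ℂ (2 + 1))) (hdim : zariskiDim ℂ W = (2 + 1 : ℕ))
    (hbase : addProjDim ℂ (2 + 1) W = 2) {ν : Fin (2 + 1) → ℤ} (hν : ν ≠ 0)
    (hst : IsTorusStable ν (W ∩ torusLocus ℂ (2 + 1))) :
    (W ∩ expGraph ℂ (2 + 1)).Nonempty := by
  refine inter_expGraph_nonempty_of_isTorusStable_three_two ?_ hW hne hrot hadd hmul hdim hbase hν hst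
  intro W' hW' hne' hrot' hadd' hmul' hdim' hbase' hper' hcyl'
  exact ecCellPeriodicStdFib_two_of_mmDensityFree h W' hW' hne' hrot' hadd' hmul' hdim' hbase' hper'
    (zariskiDim_image_dropLastMat_eq_of_isCoordCylinder hW' hne' hrot' hdim' hcyl')

end Summit.Schanuel.Schanuel.Theorems
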